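import Summits.QuantumFields.YangMills.Theorems.InfiniteVolumeSchwingerData
import Summits.QuantumFields.YangMills.Theorems.InfiniteVolumeMomentBoundsOnSides
import Summits.QuantumFields.YangMills.Theorems.BalabanLadderInfVolTranslations
import HarnessLib

/-!
# Infinite volume by compactness, class-parametric form II: the «`L → ∞` first» continuum data for ANY family of
# torus limit states with volume-free ceilings (steps 3, 4, 9 of the seat's chain, state family abstract)

HONEST FRAMING (cell `ym-fleet`, seat `ym-infvol-p2`, director-ym R136 (i); count-neutral helper for the route owner's
ruling on the «torus parity» junction, ym-beyond-p2 g20 2026-08-26T18:17:23Z, (c′) class-parametric currency and (E)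
«an infinite-volume route fed DIRECTLY by Track A reads family-volume states»).  Pure soft analysis, kernel-checked.
The ceilings (`MomentBounds6On G r a 𝓢`, resp. `TorusClass.MomentBounds6OnSides G r a 𝓣`) are HYPOTHESES (owed
E0′).  NOTHING is asserted about Bałaban's renormalisation group, uniqueness of the infinite-volume state, rotations
(E1), non-triviality (NT∕NG), a mass gap, or Clay — and it is said plainly that E1 and NT∕NG of the route's leaf still
consume the spine's ODD-torus legs (`ROT`, `LowerBounds`): this file removes the parity seam only from the DATA ∕ E0 ∕
E0′ ∕ E3 ∕ translation part of the existence-half object.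

WHAT IS PROVED ([folklore] throughout).  The seat's steps 3–4 (`exists_subseq_limit_translate_oddTorusLimitPoints`)
and 9 (`exists_ivData_core`) used `μ_k ∈ oddTorusLimitPoints r (β_k)` only through (a) the `ℤ⁴`-collar bound of the
plane-string weights (`momentBounds6_oddTorusLimitPoints`) and (b) `ℤ⁴`-translation invariance of the states.  Here
(a) is the hypothesis `MomentBounds6On G r a 𝓢` (p1's volume-free predicate, any state family `𝓢 : ℝ → Set (Measure _)`)
and (b) follows from `𝓢 β ⊆ infiniteVolumeLimitPoints r.ρ β` (p1's `isZdTranslationInvariant_of_mem_infiniteVolumeLimitPoints`):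
* §1 `translateMulti_invariant_of_tendsto_on`, **`exists_subseq_limit_translate_on`** — Banach–Alaoglu limits `S n q`
  with the E0′ bound `‖S n q F‖ ≤ 5Kⁿ‖F‖_{10n}`, convergence of the centred plane-string series on `⁰𝒮ₙ` along a
  subsequence for every affine offset scheme `‖o‖ ≤ 5a`, translation invariance of every `S n q` on `⁰𝒮ₙ`;
* §2 **`exists_ivDataOn_of_states`** — for GIVEN couplings `β_k → ∞` and states `μ_k ∈ 𝓢 (β_k)`: a subsequence `φ`,
  a one-field family `S₁` (`S₁ 0` = evaluation, `S₁ 1 = 0`, `S₁ n = Σ_{q valid} T n q`) and plane-string limits `T`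
  with the DATA-clause convergence (plaquette-CENTRE smearing, `stateMomentStr`) along `φ`, E0, E0′ (linear growth),
  E3, translation invariance on `⁰𝒮`, and the Schwartz bounds;
* §3 **`exists_ivDataOn_onSides`** — the instance for a class of RAW torus sides: from
  `TorusClass.MomentBounds6OnSides G r a 𝓣`, `𝓣` unbounded, `a > 0`, `a → 0`: couplings `β_k → ∞`, ONE strictly
  increasing side sequence `N` with `N k + 1 ∈ 𝓣`, states `μ_k` with `IsInfiniteVolumeLimitAlong r.ρ (β k) N (μ k)`
  and `(S₁, T)` as in §2 — e.g. `𝓣 = familySides` (Track A's even tori, `TorusClass.familySides_unbounded`): the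
  existence-half DATA with E0∕E0′∕E3∕translations read on Track A's OWN tori, no odd∕even transfer.

References: E. Seiler, LNP 159 (1982) Ch. 2; S. Chatterjee, arXiv:1803.01950 §2; J. Glimm, A. Jaffe, Quantum Physics
(1987) §6.1; K. Osterwalder, R. Schrader, CMP 31 (1973), CMP 42 (1975).
-/

set_option autoImplicit false

noncomputable section

open scoped BigOperators SchwartzMap
open MeasureTheory Filter Topology
open Literature.MathematicalPhysics.QuantumFieldTheory hiding ZdEdge
open Literature.MathematicalPhysics.QuantumLattice
open Literature.MathematicalPhysics.AQFT
open Literature.Probability.LatticeModels (box Site)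
open Summit.QuantumFields.YangMills.Cruxes.OSLegsFromFemtoAndGap.DlrCollarTransfer (plane exists_abs_plane_le)
open Summit.QuantumFields.YangMills.Theorems.OSLegsFromFemtoAndGap (pow_le_exp_mul_factorial)
open Summit.QuantumFields.YangMills.Cruxes.UV.TorusClass (MomentBounds6OnSides)

namespace Summit.QuantumFields.YangMills.Theorems.InfiniteVolume

variable {G : Type} [Group G] [TopologicalSpace G] [IsTopologicalGroup G] [CompactSpace G]
  [MeasurableSpace G] [BorelSpace G]

/-! ## §1 The compactness step with translations, for a family of states with volume-free ceilings -/

omit [BorelSpace G] in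
/-- **Translation invariance of the limit, state family abstract.**  Translation-invariant probability states `μ_k`
whose plane-string weights obey the `ℤ⁴`-collar bound `(C/R⁴)ⁿ` at `R·a(β_k) ≤ ℓ₄`; `0 < a(β_k) ≤ 1/24`,
`a(β_k) ≤ ℓ₄`, `a(β_k) → 0`; arity `n ≥ 2`, valid `q`, offsets `‖o k l‖ ≤ 5·a(β_k)`; ANY subsequence `φ` and ANY `S`
with `Σ'ₓ stateMomentStr(μ_{φ j}) n q x·F(a(β_{φ j})·x + o (φ j)) → S F` on `⁰𝒮ₙ`: then `S (translateMulti t F) = S F`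
on `⁰𝒮ₙ`. [folklore] -/
theorem translateMulti_invariant_of_tendsto_on (r : LatticeRep G) {a : ℝ → ℝ} {C ℓ₄ : ℝ} (hℓ : 0 < ℓ₄) (hC : 0 ≤ C)
    (β : ℕ → ℝ) (ha : ∀ k, 0 < a (β k)) (ha24 : ∀ k, a (β k) ≤ 1 / 24) (haℓ : ∀ k, a (β k) ≤ ℓ₄)
    (ha0 : Tendsto (fun k => a (β k)) atTop (𝓝 0))
    (μ : ℕ → Measure (LGConfig 4 G)) [∀ k, IsProbabilityMeasure (μ k)] (hinv : ∀ k, IsZdTranslationInvariant (μ k))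
    (hcol : ∀ (k n : ℕ) (q : Fin n → Fin 4 × Fin 4) (x : Fin n → Site 4) (R : ℕ), (∀ i, (q i).1 < (q i).2) →
      1 ≤ R → (R : ℝ) * a (β k) ≤ ℓ₄ →
      (∀ i j : Fin n, i ≠ j → ∃ m : Fin 4, (2 * (R : ℤ) + 4) ≤ |x i m - x j m|) →
      |stateMomentStr G r (μ k) n q x| ≤ (C / (R : ℝ) ^ 4) ^ n)
    {n : ℕ} (hn : 2 ≤ n) (q : Fin n → Fin 4 × Fin 4) (hq : ∀ i, (q i).1 < (q i).2)
    (o : ℕ → Fin n → EuclideanSpace ℝ (Fin 4)) (ho : ∀ k l, ‖o k l‖ ≤ 5 * a (β k))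
    {φ : ℕ → ℕ} (hφ : StrictMono φ) (S : 𝓢((Fin n → EuclideanSpace ℝ (Fin 4)), ℂ) → ℂ)
    (hconv : ∀ F : 𝓢((Fin n → EuclideanSpace ℝ (Fin 4)), ℂ), IsOffDiagonal F →
      Tendsto (fun j => ∑' x : Fin n → Site 4, ((stateMomentStr G r (μ (φ j)) n q x : ℝ) : ℂ) *
        F (fun l => a (β (φ j)) • siteToE (x l) + o (φ j) l)) atTop (𝓝 (S F)))
    (t : EuclideanSpace ℝ (Fin 4)) (F : 𝓢((Fin n → EuclideanSpace ℝ (Fin 4)), ℂ)) (hF : IsOffDiagonal F) :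
    S (translateMulti t F) = S F := by
  obtain ⟨Cp, hCp⟩ := exists_abs_plane_le (G := G) r
  have hCp0 : 0 ≤ Cp := le_trans (abs_nonneg _) (hCp (0, 1) 0 (fun _ => 1))
  have ha1 : ∀ k, a (β k) ≤ 1 := fun k => (ha24 k).trans (by norm_num)
  have hsa : ∀ k, 6 * a (β k) ≤ 1 / 4 := fun k => by linarith [ha24 k]
  -- shorthand: weights, evaluation maps
  set W : ℕ → (Fin n → Site 4) → ℝ := fun k x => stateMomentStr G r (μ k) n q x with hWdef
  set y : ℕ → (Fin n → Site 4) → (Fin n → EuclideanSpace ℝ (Fin 4)) := fun k x l =>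
    a (β k) • siteToE (x l) + o k l with hydef
  have hyx : ∀ k x l, ‖y k x l - a (β k) • siteToE (x l)‖ ≤ 6 * a (β k) := fun k x l => by
    simp only [hydef, add_sub_cancel_left]
    linarith [ho k l, (ha k).le]
  have hWsup : ∀ k x, |W k x| ≤ (Cp + Cp) ^ n := fun k x => abs_infVolWeight_le r hCp (μ k) q x
  have hWcol : ∀ k (x : Fin n → Site 4) (R : ℕ), 1 ≤ R → (R : ℝ) * a (β k) ≤ ℓ₄ →
      (∀ i j : Fin n, i ≠ j → ∃ m : Fin 4, (2 * (R : ℤ) + 4) ≤ |x i m - x j m|) →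
      |W k x| ≤ (C / (R : ℝ) ^ 4) ^ n := fun k x R hR hRa hsep => hcol k n q x R hq hR hRa hsep
  -- the functionals along `φ`
  set s : ℕ → 𝓢((Fin n → EuclideanSpace ℝ (Fin 4)), ℂ) → ℂ := fun j F =>
    ∑' x : Fin n → Site 4, ((W (φ j) x : ℝ) : ℂ) * F (y (φ j) x) with hsdef
  have hsum : ∀ j (F : 𝓢((Fin n → EuclideanSpace ℝ (Fin 4)), ℂ)),
      Summable fun x : Fin n → Site 4 => ((W (φ j) x : ℝ) : ℂ) * F (y (φ j) x) := fun j F =>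
    summable_mul_of_bounded (ha (φ j)) (ha1 (φ j)) (hsa (φ j)) (pow_nonneg (by positivity) n) (W (φ j))
      (hWsup (φ j)) F (y (φ j)) (hyx (φ j))
  have hsub : ∀ j (F G' : 𝓢((Fin n → EuclideanSpace ℝ (Fin 4)), ℂ)), IsOffDiagonal F → IsOffDiagonal G' →
      s j (F - G') = s j F - s j G' := fun j F G' _ _ => by
    simp only [hsdef]
    rw [← Summable.tsum_sub (hsum j F) (hsum j G')]
    exact tsum_congr fun x => by simp only [sub_apply]; ring
  set K : ℝ := ((Cp + Cp) * 4 ^ 4 * 5 ^ 6 + (Cp + Cp) * 2 ^ 6 * (10 + 2 * 6) ^ 4 +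
      16 * C * 2 ^ 6 * (2 / ℓ₄ + 48) ^ 4) * 2 ^ 6 * (81 * ∑' m : ℕ, (((m : ℝ) + 1) ^ 2)⁻¹) with hK
  have hbd : ∀ j (F : 𝓢((Fin n → EuclideanSpace ℝ (Fin 4)), ℂ)), IsOffDiagonal F →
      ‖s j F‖ ≤ 5 * K ^ n * schwartzNorm (10 * n) F := fun j F hF =>
    norm_tsum_weight_mul_le hℓ hC (by positivity : 0 ≤ Cp + Cp) (W (φ j)) (hWsup (φ j)) (hWcol (φ j))
      (ha (φ j)) (ha1 (φ j)) (haℓ (φ j)) hn (by norm_num) le_rfl (hsa (φ j)) F hF (y (φ j)) (hyx (φ j))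
  -- lattice vectors approximating `t`, exact invariance along the sequence
  have hv := fun j => exists_latticeVector_near (ha (φ j)) t
  choose v hv using hv
  have hbt : Tendsto (fun j => a (β (φ j)) • siteToE (v j)) atTop (𝓝 t) := by
    have ha0' : Tendsto (fun j => 2 * a (β (φ j))) atTop (𝓝 0) := by
      simpa using (ha0.comp hφ.tendsto_atTop).const_mul 2
    rw [tendsto_iff_norm_sub_tendsto_zero]
    refine squeeze_zero (fun j => norm_nonneg _) (fun j => ?_) ha0'
    rw [norm_sub_rev]; exact hv j
  have hinv' : ∀ j (F : 𝓢((Fin n → EuclideanSpace ℝ (Fin 4)), ℂ)), IsOffDiagonal F →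
      s j (translateMulti (a (β (φ j)) • siteToE (v j)) F) = s j F := fun j F _ => by
    simp only [hsdef, hydef]
    exact tsum_weight_mul_translateMulti (W (φ j)) (v j)
      (fun x => stateMomentStr_translate r (hinv (φ j)) n q x (v j)) _ (o (φ j)) F
  exact translate_eq_of_tendsto s S hsub hbd hconv hbt hinv' F hF

/-- **THE COMPACTNESS STEP WITH TRANSLATIONS, for any family of torus limit states with volume-free ceilings.**  From
`MomentBounds6On G r a 𝓢` and `𝓢 β ⊆ infiniteVolumeLimitPoints r.ρ β`: thresholds `β₄`, `ℓ₄` and ONE `K` such that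
for every coupling sequence `β_k ≥ β₄` with `0 < a(β_k) ≤ min (1/24) ℓ₄` AND `a(β_k) → 0`, every choice of states
`μ_k ∈ 𝓢 (β_k)` and every affine offset scheme `o` (`‖o k n q l‖ ≤ 5·a(β_k)`) there are a subsequence `φ` and
continuous linear functionals `S n q` with the E0′ bound, convergence of the centred plane-string series of `μ_{φ j}`
on `⁰𝒮ₙ` (`n ≥ 2`, valid `q`), AND `S n q (translateMulti t F) = S n q F` on `⁰𝒮ₙ`. [folklore] -/
theorem exists_subseq_limit_translate_on (r : LatticeRep G) {a : ℝ → ℝ} {𝓢 : ℝ → Set (Measure (LGConfig 4 G))}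
    (hMB : MomentBounds6On G r a 𝓢) (h𝓢 : ∀ β, 𝓢 β ⊆ infiniteVolumeLimitPoints (d := 4) r.ρ β) :
    ∃ (β₄ ℓ₄ K : ℝ), 0 < ℓ₄ ∧ 0 ≤ K ∧
      ∀ (β : ℕ → ℝ), (∀ k, β₄ ≤ β k) → (∀ k, 0 < a (β k)) → (∀ k, a (β k) ≤ 1 / 24) → (∀ k, a (β k) ≤ ℓ₄) →
        Tendsto (fun k => a (β k)) atTop (𝓝 0) →
      ∀ (μ : ℕ → Measure (LGConfig 4 G)), (∀ k, μ k ∈ 𝓢 (β k)) →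
      ∀ (o : ℕ → (n : ℕ) → (Fin n → Fin 4 × Fin 4) → Fin n → EuclideanSpace ℝ (Fin 4)),
        (∀ k n q l, ‖o k n q l‖ ≤ 5 * a (β k)) →
      ∃ φ : ℕ → ℕ, StrictMono φ ∧
        ∃ S : (n : ℕ) → (Fin n → Fin 4 × Fin 4) → (𝓢((Fin n → EuclideanSpace ℝ (Fin 4)), ℂ) →L[ℂ] ℂ),
          (∀ n q F, ‖S n q F‖ ≤ 5 * K ^ n * schwartzNorm (10 * n) F) ∧
          (∀ n : ℕ, 2 ≤ n → ∀ q : Fin n → Fin 4 × Fin 4, (∀ i, (q i).1 < (q i).2) →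
            ∀ F : 𝓢((Fin n → EuclideanSpace ℝ (Fin 4)), ℂ), IsOffDiagonal F →
              Tendsto (fun j => ∑' x : Fin n → Site 4, ((stateMomentStr G r (μ (φ j)) n q x : ℝ) : ℂ) *
                F (fun l => a (β (φ j)) • siteToE (x l) + o (φ j) n q l)) atTop (𝓝 (S n q F))) ∧
          ∀ n : ℕ, 2 ≤ n → ∀ q : Fin n → Fin 4 × Fin 4, (∀ i, (q i).1 < (q i).2) →
            ∀ (t : EuclideanSpace ℝ (Fin 4)) (F : 𝓢((Fin n → EuclideanSpace ℝ (Fin 4)), ℂ)), IsOffDiagonal F →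
              S n q (translateMulti t F) = S n q F := by
  obtain ⟨C, β₄, ℓ₄, hℓ, hC, H⟩ := hMB
  obtain ⟨Cp, hCp⟩ := exists_abs_plane_le (G := G) r
  have hCp0 : 0 ≤ Cp := le_trans (abs_nonneg _) (hCp (0, 1) 0 (fun _ => 1))
  refine ⟨β₄, ℓ₄, ((Cp + Cp) * 4 ^ 4 * 5 ^ 6 + (Cp + Cp) * 2 ^ 6 * (10 + 2 * 6) ^ 4 +
      16 * C * 2 ^ 6 * (2 / ℓ₄ + 48) ^ 4) * 2 ^ 6 * (81 * ∑' m : ℕ, (((m : ℝ) + 1) ^ 2)⁻¹), hℓ, ?_, ?_⟩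
  · have : 0 ≤ ∑' m : ℕ, (((m : ℝ) + 1) ^ 2)⁻¹ := tsum_nonneg fun m => by positivity
    positivity
  intro β hβ ha ha24 haℓ ha0 μ hμ o ho
  haveI : ∀ k, IsProbabilityMeasure (μ k) := fun k => by
    obtain ⟨N, -, hlim⟩ := h𝓢 (β k) (hμ k)
    exact hlim.1
  have hinv : ∀ k, IsZdTranslationInvariant (μ k) := fun k =>
    isZdTranslationInvariant_of_mem_infiniteVolumeLimitPoints r (h𝓢 (β k) (hμ k))
  have hcol : ∀ (k n : ℕ) (q : Fin n → Fin 4 × Fin 4) (x : Fin n → Site 4) (R : ℕ), (∀ i, (q i).1 < (q i).2) →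
      1 ≤ R → (R : ℝ) * a (β k) ≤ ℓ₄ →
      (∀ i j : Fin n, i ≠ j → ∃ m : Fin 4, (2 * (R : ℤ) + 4) ≤ |x i m - x j m|) →
      |stateMomentStr G r (μ k) n q x| ≤ (C / (R : ℝ) ^ 4) ^ n := fun k n q x R hq hR hRa hsep =>
    H (β k) (hβ k) (μ k) (hμ k) n q x R hq hR hRa hsep
  have hy : ∀ k n (q : Fin n → Fin 4 × Fin 4) (x : Fin n → Site 4) l,
      ‖(fun l => a (β k) • siteToE (x l) + o k n q l) l - a (β k) • siteToE (x l)‖ ≤ 6 * a (β k) :=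
    fun k n q x l => by
      simp only [add_sub_cancel_left]
      linarith [ho k n q l, (ha k).le]
  obtain ⟨φ, hφ, S, hS, hconv⟩ := exists_subseq_limit_of_zdCollar hℓ hC (by positivity : 0 ≤ Cp + Cp)
    (fun k => a (β k)) ha ha24 haℓ (fun k n q x => stateMomentStr G r (μ k) n q x)
    (fun k n q x => abs_infVolWeight_le r hCp (μ k) q x)
    (fun k n q hq x R hR hRa hsep => hcol k n q x R hq hR hRa hsep)
    (fun k n q x l => a (β k) • siteToE (x l) + o k n q l) hy
  refine ⟨φ, hφ, S, hS, hconv, fun n hn q hq t F hF => ?_⟩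
  exact translateMulti_invariant_of_tendsto_on r hℓ hC β ha ha24 haℓ ha0 μ hinv hcol hn q hq
    (fun k l => o k n q l) (fun k l => ho k n q l) hφ (S n q) (fun F' hF' => hconv n hn q hq F' hF') t F hF

/-! ## §2 The one-field data for GIVEN couplings and states -/

/-- **The «`L → ∞` first» one-field data for given states of a family with volume-free ceilings.**  `a > 0`, `a → 0`,
`MomentBounds6On G r a 𝓢`, `𝓢 β ⊆ infiniteVolumeLimitPoints r.ρ β`; couplings `β_k → ∞` and states `μ_k ∈ 𝓢 (β_k)`.
Then along a strictly increasing `φ` there are a one-field family `S₁` (`S₁ 0` = evaluation, `S₁ 1 = 0`,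
`S₁ n = Σ_{q valid} T n q`) and plane-string limits `T` with: convergence of the plaquette-CENTRE-smeared series
`Σ'ₓ stateMomentStr G r μ_{φ k} n q x · F(a(β_{φ k})·x + (a(β_{φ k})/2)(e_{q.1}+e_{q.2}))` to `T n q F` on `⁰𝒮ₙ`
(`n ≥ 2`, valid `q`), E0, E0′ (linear growth), E3, translation invariance on `⁰𝒮`, and the Schwartz bounds
`‖T n q F‖ ≤ 5Kⁿ‖F‖_{10n}`, `‖S₁ n F‖ ≤ 5(6K)ⁿ‖F‖_{10n}`. [folklore] -/
theorem exists_ivDataOn_of_states (r : LatticeRep G) {a : ℝ → ℝ} (hapos : ∀ β, 0 < a β)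
    (ha0 : Tendsto a atTop (𝓝 0)) {𝓢 : ℝ → Set (Measure (LGConfig 4 G))} (hMB : MomentBounds6On G r a 𝓢)
    (h𝓢 : ∀ β, 𝓢 β ⊆ infiniteVolumeLimitPoints (d := 4) r.ρ β)
    (β : ℕ → ℝ) (hβ : Tendsto β atTop atTop) (μ : ℕ → Measure (LGConfig 4 G)) (hμ : ∀ k, μ k ∈ 𝓢 (β k)) :
    ∃ (φ : ℕ → ℕ), StrictMono φ ∧ ∃ (S₁ : SchwingerFamily (EuclideanSpace ℝ (Fin 4)))
      (T : (n : ℕ) → (Fin n → Fin 4 × Fin 4) → (𝓢((Fin n → EuclideanSpace ℝ (Fin 4)), ℂ) →L[ℂ] ℂ)),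
      (∀ F : 𝓢((Fin 0 → EuclideanSpace ℝ (Fin 4)), ℂ), S₁ 0 F = F default) ∧
      (∀ F : 𝓢((Fin 1 → EuclideanSpace ℝ (Fin 4)), ℂ), S₁ 1 F = 0) ∧
      (∀ n : ℕ, 2 ≤ n → ∀ F : 𝓢((Fin n → EuclideanSpace ℝ (Fin 4)), ℂ),
        S₁ n F = ∑ q ∈ Fintype.piFinset (fun _ : Fin n => Finset.univ.filter fun p : Fin 4 × Fin 4 => p.1 < p.2),
          T n q F) ∧
      (∀ n : ℕ, 2 ≤ n → ∀ q : Fin n → Fin 4 × Fin 4, (∀ i, (q i).1 < (q i).2) →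
        ∀ F : 𝓢((Fin n → EuclideanSpace ℝ (Fin 4)), ℂ), IsOffDiagonal F →
          Tendsto (fun k => ∑' x : Fin n → Site 4, ((stateMomentStr G r (μ (φ k)) n q x : ℝ) : ℂ) *
            F (fun l => a (β (φ k)) • siteToE (x l) +
              (a (β (φ k)) / 2) • (EuclideanSpace.single (q l).1 (1 : ℝ) + EuclideanSpace.single (q l).2 (1 : ℝ))))
            atTop (𝓝 (T n q F))) ∧
      S₁.toLabelled.IsNormalized ∧ S₁.toLabelled.HasLinearGrowth ∧ S₁.toLabelled.IsSymmetric ∧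
      (∀ (n : ℕ) (t : EuclideanSpace ℝ (Fin 4)) (F : 𝓢((Fin n → EuclideanSpace ℝ (Fin 4)), ℂ)), IsOffDiagonal F →
        S₁ n (translateMulti t F) = S₁ n F) ∧
      (∃ K : ℝ, 0 ≤ K ∧ (∀ n q F, ‖T n q F‖ ≤ 5 * K ^ n * schwartzNorm (10 * n) F) ∧
        ∀ n F, ‖S₁ n F‖ ≤ 5 * (6 * K) ^ n * schwartzNorm (10 * n) F) := by
  classical
  obtain ⟨β₄, ℓ₄, K, hℓ, hK, Hex⟩ := exists_subseq_limit_translate_on r hMB h𝓢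
  -- thresholds hold from some index `k₀` on: pass to the tail
  obtain ⟨B₁, hB₁⟩ : ∃ B₁ : ℝ, ∀ b, B₁ ≤ b → a b < min (1 / 24) ℓ₄ :=
    Filter.eventually_atTop.1 (ha0.eventually (gt_mem_nhds (by positivity)))
  obtain ⟨k₀, hk₀⟩ := Filter.eventually_atTop.1 (hβ.eventually (eventually_ge_atTop (max β₄ B₁)))
  set βs : ℕ → ℝ := fun k => β (k + k₀) with hβs
  have hβs4 : ∀ k, β₄ ≤ βs k := fun k => le_trans (le_max_left _ _) (hk₀ _ (Nat.le_add_left _ _))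
  have hβs1 : ∀ k, B₁ ≤ βs k := fun k => le_trans (le_max_right _ _) (hk₀ _ (Nat.le_add_left _ _))
  have hβs_top : Tendsto βs atTop atTop := hβ.comp (tendsto_add_atTop_nat k₀)
  have ha_pos : ∀ k, 0 < a (βs k) := fun k => hapos _
  have ha_24 : ∀ k, a (βs k) ≤ 1 / 24 := fun k => (hB₁ _ (hβs1 k)).le.trans (min_le_left _ _)
  have ha_ℓ : ∀ k, a (βs k) ≤ ℓ₄ := fun k => (hB₁ _ (hβs1 k)).le.trans (min_le_right _ _)
  have ha_top : Tendsto (fun k => a (βs k)) atTop (𝓝 0) := ha0.comp hβs_top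
  set μs : ℕ → Measure (LGConfig 4 G) := fun k => μ (k + k₀) with hμs
  have hμs : ∀ k, μs k ∈ 𝓢 (βs k) := fun k => hμ _
  -- plaquette-centre offsets
  set o : ℕ → (n : ℕ) → (Fin n → Fin 4 × Fin 4) → Fin n → EuclideanSpace ℝ (Fin 4) := fun k n q l =>
    (a (βs k) / 2) • (EuclideanSpace.single (q l).1 (1 : ℝ) + EuclideanSpace.single (q l).2 (1 : ℝ)) with ho
  have hob : ∀ k n (q : Fin n → Fin 4 × Fin 4) l, ‖o k n q l‖ ≤ 5 * a (βs k) := fun k n q l =>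
    norm_centreOffset_le (ha_pos k).le (q l)
  -- the compactness step with translations
  obtain ⟨φ, hφ, T, hTb, hconv, htrans⟩ := Hex βs hβs4 ha_pos ha_24 ha_ℓ ha_top μs hμs o hob
  -- the one-field family
  let P : (n : ℕ) → Finset (Fin n → Fin 4 × Fin 4) := fun n =>
    Fintype.piFinset (fun _ : Fin n => Finset.univ.filter fun p : Fin 4 × Fin 4 => p.1 < p.2)
  let S₁ : SchwingerFamily (EuclideanSpace ℝ (Fin 4)) := fun n =>
    if n = 0 then LabelledSchwingerFamily.evalAt default else if n = 1 then 0 else ∑ q ∈ P n, T n q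
  have hS₁0' : S₁ 0 = LabelledSchwingerFamily.evalAt default := rfl
  have hS₁1' : S₁ 1 = 0 := rfl
  have hS₁0 : ∀ F : 𝓢((Fin 0 → EuclideanSpace ℝ (Fin 4)), ℂ), S₁ 0 F = F default := fun F => by
    rw [hS₁0', LabelledSchwingerFamily.evalAt_apply]
  have hS₁1 : ∀ F : 𝓢((Fin 1 → EuclideanSpace ℝ (Fin 4)), ℂ), S₁ 1 F = 0 := fun F => by
    rw [hS₁1']; rfl
  have hS₁2 : ∀ n : ℕ, 2 ≤ n → ∀ F : 𝓢((Fin n → EuclideanSpace ℝ (Fin 4)), ℂ),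
      S₁ n F = ∑ q ∈ P n, T n q F := fun n hn F => by
    have h : S₁ n = ∑ q ∈ P n, T n q := by
      simp only [S₁, if_neg (show n ≠ 0 by omega), if_neg (show n ≠ 1 by omega)]
    rw [h, FunLike.coe_sum, Finset.sum_apply]
  -- the convergence clause along the re-indexed sequence
  have hconv' : ∀ n : ℕ, 2 ≤ n → ∀ q : Fin n → Fin 4 × Fin 4, (∀ i, (q i).1 < (q i).2) →
      ∀ F : 𝓢((Fin n → EuclideanSpace ℝ (Fin 4)), ℂ), IsOffDiagonal F →
        Tendsto (fun k => ∑' x : Fin n → Site 4, ((stateMomentStr G r (μs (φ k)) n q x : ℝ) : ℂ) *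
          F (fun l => a (βs (φ k)) • siteToE (x l) +
            (a (βs (φ k)) / 2) • (EuclideanSpace.single (q l).1 (1 : ℝ) + EuclideanSpace.single (q l).2 (1 : ℝ))))
          atTop (𝓝 (T n q F)) := fun n hn q hq F hF => hconv n hn q hq F hF
  -- the uniform bounds
  have hbdS₁ : ∀ n (F : 𝓢((Fin n → EuclideanSpace ℝ (Fin 4)), ℂ)),
      ‖S₁ n F‖ ≤ 5 * (6 * K) ^ n * schwartzNorm (10 * n) F := by
    intro n F
    rcases Nat.lt_or_ge n 2 with hn | hn
    · interval_cases n
      · rw [hS₁0]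
        have h1 := norm_le_schwartzNorm 0 F default
        have h0 := schwartzNorm_nonneg 0 F
        simp only [pow_zero, mul_one, mul_zero]
        linarith
      · rw [hS₁1, norm_zero]; exact mul_nonneg (by positivity) (schwartzNorm_nonneg _ _)
    · rw [hS₁2 n hn]
      calc _ ≤ ∑ q ∈ P n, ‖T n q F‖ := norm_sum_le _ _
        _ ≤ ∑ _q ∈ P n, 5 * K ^ n * schwartzNorm (10 * n) F := Finset.sum_le_sum fun q _ => hTb n q F
        _ = 6 ^ n * (5 * K ^ n * schwartzNorm (10 * n) F) := by
            rw [Finset.sum_const, nsmul_eq_mul, card_validStrings]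
        _ = 5 * (6 * K) ^ n * schwartzNorm (10 * n) F := by rw [mul_pow]; ring
  have hφ' : StrictMono fun k => φ k + k₀ := fun i j hij => by simpa using hφ hij
  refine ⟨fun k => φ k + k₀, hφ', S₁, T, hS₁0, hS₁1, hS₁2, hconv', fun _ F => ?_, ?_, ?_, ?_,
    ⟨K, hK, hTb, hbdS₁⟩⟩
  · -- E0
    rw [SchwingerFamily.toLabelled_apply, hS₁0]
    exact congrArg F (Subsingleton.elim _ _)
  · -- E0′
    intro _
    have h6K : 0 ≤ 6 * K := by positivity
    refine ⟨10, 5 * Real.exp (6 * K), 1, fun n k _ F _ => ?_⟩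
    simp only [SchwingerFamily.toLabelled_apply, Real.rpow_one]
    calc ‖S₁ n F‖ ≤ 5 * (6 * K) ^ n * schwartzNorm (10 * n) F := hbdS₁ n F
      _ ≤ 5 * (Real.exp (6 * K) * (n.factorial : ℝ)) * schwartzNorm (10 * n) F := by
          gcongr
          · exact schwartzNorm_nonneg _ _
          · exact pow_le_exp_mul_factorial h6K n
      _ = 5 * Real.exp (6 * K) * (n.factorial : ℝ) * schwartzNorm (n * 10) F := by rw [mul_comm n 10]; ring
  · -- E3
    intro n k π F hF
    simp only [SchwingerFamily.toLabelled_apply]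
    rcases Nat.lt_or_ge n 2 with hn | hn
    · interval_cases n
      · rw [hS₁0, hS₁0]
        exact (permTest_apply π F default).trans (congrArg F (Subsingleton.elim _ _))
      · rw [hS₁1, hS₁1]
    · rw [hS₁2 n hn, hS₁2 n hn]
      exact sum_limit_permTest_eq r (fun k => μs (φ k)) (fun k => a (βs (φ k)))
        (fun k p => (a (βs (φ k)) / 2) • (EuclideanSpace.single p.1 (1 : ℝ) + EuclideanSpace.single p.2 (1 : ℝ)))
        (fun q F => T n q F) (fun q hq F' hF' => hconv n hn q hq F' hF') π F hF
  · -- translations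
    intro n t F hF
    rcases Nat.lt_or_ge n 2 with hn | hn
    · interval_cases n
      · rw [hS₁0, hS₁0]
        exact (translateMulti_apply t F default).trans (congrArg F (Subsingleton.elim _ _))
      · rw [hS₁1, hS₁1]
    · rw [hS₁2 n hn, hS₁2 n hn]
      refine Finset.sum_congr rfl fun q hq => ?_
      have hqv : ∀ i, (q i).1 < (q i).2 := fun i => by
        have := (Fintype.mem_piFinset.1 hq) i
        exact (Finset.mem_filter.1 this).2
      exact htrans n hn q hqv t F hF

/-! ## §3 The instance for a class of raw torus sides (e.g. Track A's family tori) -/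

/-- **The «`L → ∞` first» one-field data read on the tori of ANY unbounded class of raw sides.**  From
`TorusClass.MomentBounds6OnSides G r a 𝓣` (E0′ ceilings on the tori `(ℤ/Mℤ)⁴`, `M ∈ 𝓣`), `𝓣` unbounded, `a > 0`,
`a → 0`: couplings `β_k → ∞`, ONE strictly increasing side sequence `N` with `N k + 1 ∈ 𝓣`, infinite-volume states
`μ_k` with `IsInfiniteVolumeLimitAlong r.ρ (β k) N (μ k)`, and `(S₁, T)` with the DATA-clause convergence (centre
smearing), E0, E0′, E3, translation invariance on `⁰𝒮` and the Schwartz bounds.  With `𝓣 = TorusClass.familySides`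
(`familySides_unbounded`) the states are read on Track A's OWN (even) family tori — no odd∕even transfer enters.
E1 and NT∕NG are NOT produced here (they consume the spine's odd-torus legs). [folklore] -/
theorem exists_ivDataOn_onSides (r : LatticeRep G) {a : ℝ → ℝ} (hapos : ∀ β, 0 < a β)
    (ha0 : Tendsto a atTop (𝓝 0)) {𝓣 : Set ℕ} (hMB : MomentBounds6OnSides G r a 𝓣)
    (h𝓣 : ∀ m : ℕ, ∃ M ∈ 𝓣, m ≤ M) :
    ∃ (β : ℕ → ℝ) (N : ℕ → ℕ) (μ : ℕ → Measure (LGConfig 4 G)) (S₁ : SchwingerFamily (EuclideanSpace ℝ (Fin 4)))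
      (T : (n : ℕ) → (Fin n → Fin 4 × Fin 4) → (𝓢((Fin n → EuclideanSpace ℝ (Fin 4)), ℂ) →L[ℂ] ℂ)),
      Tendsto β atTop atTop ∧ StrictMono N ∧ (∀ k, N k + 1 ∈ 𝓣) ∧
      (∀ k, IsInfiniteVolumeLimitAlong (d := 4) r.ρ (β k) N (μ k)) ∧
      (∀ F : 𝓢((Fin 0 → EuclideanSpace ℝ (Fin 4)), ℂ), S₁ 0 F = F default) ∧
      (∀ F : 𝓢((Fin 1 → EuclideanSpace ℝ (Fin 4)), ℂ), S₁ 1 F = 0) ∧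
      (∀ n : ℕ, 2 ≤ n → ∀ F : 𝓢((Fin n → EuclideanSpace ℝ (Fin 4)), ℂ),
        S₁ n F = ∑ q ∈ Fintype.piFinset (fun _ : Fin n => Finset.univ.filter fun p : Fin 4 × Fin 4 => p.1 < p.2),
          T n q F) ∧
      (∀ n : ℕ, 2 ≤ n → ∀ q : Fin n → Fin 4 × Fin 4, (∀ i, (q i).1 < (q i).2) →
        ∀ F : 𝓢((Fin n → EuclideanSpace ℝ (Fin 4)), ℂ), IsOffDiagonal F →
          Tendsto (fun k => ∑' x : Fin n → Site 4, ((stateMomentStr G r (μ k) n q x : ℝ) : ℂ) *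
            F (fun l => a (β k) • siteToE (x l) +
              (a (β k) / 2) • (EuclideanSpace.single (q l).1 (1 : ℝ) + EuclideanSpace.single (q l).2 (1 : ℝ))))
            atTop (𝓝 (T n q F))) ∧
      S₁.toLabelled.IsNormalized ∧ S₁.toLabelled.HasLinearGrowth ∧ S₁.toLabelled.IsSymmetric ∧
      (∀ (n : ℕ) (t : EuclideanSpace ℝ (Fin 4)) (F : 𝓢((Fin n → EuclideanSpace ℝ (Fin 4)), ℂ)), IsOffDiagonal F →
        S₁ n (translateMulti t F) = S₁ n F) ∧
      (∃ K : ℝ, 0 ≤ K ∧ (∀ n q F, ‖T n q F‖ ≤ 5 * K ^ n * schwartzNorm (10 * n) F) ∧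
        ∀ n F, ‖S₁ n F‖ ≤ 5 * (6 * K) ^ n * schwartzNorm (10 * n) F) := by
  -- the state family of limits along `𝓣`: ceilings (class inheritance) and membership in the torus limit points
  set 𝓢 : ℝ → Set (Measure (LGConfig 4 G)) := fun b => {ν | ∃ N : ℕ → ℕ, StrictMono N ∧ (∀ k, N k + 1 ∈ 𝓣) ∧
    IsInfiniteVolumeLimitAlong (d := 4) r.ρ b N ν} with h𝓢def
  have hMBOn : MomentBounds6On G r a 𝓢 := momentBounds6On_of_onSides r hMB
  have h𝓢 : ∀ b, 𝓢 b ⊆ infiniteVolumeLimitPoints (d := 4) r.ρ b := fun b ν hν => by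
    obtain ⟨N, hN, -, hlim⟩ := hν
    exact ⟨N, hN, hlim⟩
  -- couplings `β k = k`, states along one side sequence in the class
  obtain ⟨N, hN, hN𝓣, μ, hμ⟩ := exists_strictMono_forall_limitAlong_of_unbounded r (fun k => (k : ℝ)) h𝓣
  have hμmem : ∀ k : ℕ, μ k ∈ 𝓢 ((k : ℕ) : ℝ) := fun k => ⟨N, hN, hN𝓣, (hμ k).2⟩
  obtain ⟨φ, hφ, S₁, T, h0, h1, h2, hconv, hN', hLG, hE3, htr, hbds⟩ :=
    exists_ivDataOn_of_states r hapos ha0 hMBOn h𝓢 (fun k => (k : ℝ)) tendsto_natCast_atTop_atTop μ hμmem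
  exact ⟨fun k => ((φ k : ℕ) : ℝ), N, fun k => μ (φ k), S₁, T, tendsto_natCast_atTop_atTop.comp hφ.tendsto_atTop,
    hN, hN𝓣, fun k => (hμ (φ k)).2, h0, h1, h2, hconv, hN', hLG, hE3, htr, hbds⟩

end Summit.QuantumFields.YangMills.Theorems.InfiniteVolume

end
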